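import Literature.MathematicalPhysics.QuantumFieldTheory.Balaban1983to89.B9Eq342CombesThomasFormZd

/-!
# `Balaban1983to89.B9Eq342CombesThomasBlockForm` — [Balaban1985BackgroundPropagators] (3.42) p. 397 ∕ Thm 3.1 p. 397 ∕ Thm 3.3 p. 399 ∕ Thm 3.11 p. 416: THE
# COMBES–THOMAS ENGINE OF `B9Eq342CombesThomasFormZd`, CARRIER-GENERIC — for ANY real carrier `V` read through coordinate maps `π_i : V → F`, `σ_i : F → V`
# over a finite index set (sites: `L²(Ω₀, ·)` of (3.24); level data: `L²(𝔅, ·)` of (3.25); bonds: `E(Ω₀)`, `E_𝔤(Ω₀)` of (3.26)–(3.27)), a fibre `F` with a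
# positive symmetric form `β`, an ℝ-linear `T` that is COERCIVE for `Σ_i β(π_i ·, π_i ·)` and whose blocks `π_i T σ_j` admit an EXPONENTIALLY WEIGHTED SCHUR
# MAJORANT: every solution of `Tg = σ_y w` obeys `β-size(π_x g) ≤ e^{−κ·dist(x,y)}·β-size(w) ∕ (c − ϱ)`

statement-level skeleton of published theorems with citation tags; proofs where landed; nothing here is a claim about the
Yang–Mills mass gap

`[Balaban1985BackgroundPropagators]` ("B9", CMP **99** (1985) 389–434): (3.42) p. 397 *«|(G′(U)λ)(x)| ≦ B₀(Lʲη)²e^{−δ₀d(y,y′)}|λ| for x ∈ Δ(y), y ∈ Λ_j,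
supp λ ⊂ Δ(y′)»* and Thms 3.1 p. 397 ∕ 3.3 p. 399 (the kernels of `G′`, `G` decay exponentially), Thm 3.11 p. 416 («Δ′_a, G′, (Q′G′²Q′*)⁻¹, Δ_a, G are positive definite»), [Balaban1984PropagatorsII] p. 226 («bounded from below by a positive
constant»); the conjugation device: [Balaban1988RG2Cluster] (2.5)–(2.7) pp. 12–13, (2.16) p. 16.  Print proves the decay by random-walk expansions; the route's
substitute at a finite member is the Combes–Thomas conjugation, typed for the site carrier in `B9Eq342CombesThomasFormZd` (this seat, FILE A).  THIS FILE is
the SAME argument with the carrier abstracted, so that the three other carriers of the `ℤᵈ` frame — dag-n06-w4 g2's level data `levSupp ∕ levForm`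
(`(Q′G′²Q′*)⁻¹`, (3.25)), dag-n06-w4 g2 ∕ dag-n06-b g18's bond carriers `domSub ∕ domSubH` with `bondPair` (`G = Δ_a⁻¹`, `G_𝔤`, (3.26)–(3.27)) — instantiate it by
a dictionary instead of a copy: the carrier is any real space `V` with «coordinates» `π_i` and «single-site injections» `σ_i` (`Σ_{i∈s} σ_i π_i = id`,
`π_i σ_i = id`, `π_i σ_j = 0` for `i ≠ j`), the fibre any real space `F` with a symmetric non-negative form `β` (for `E_𝔤`: the self-adjoint part with `Re τ(a*b)`).

CITATION HEADER (lean-in-tree rule).  Cell `pub-ymgap` (YM Track A, HUMAN RULING D-0062 ∕ D-0149 width push), DAG node N06 = [B9], width seat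
`pub-ymgap-dag-n06-w2` (g4), CLAIM-3 FILE C.  Inputs BY NAME: FILE A's generic Cauchy–Schwarz `abs_bilin_le_sqrt_mul_sqrt`, weight lemma
`abs_exp_weight_sub_one_le`, Lipschitz lemma `abs_dist_sub_dist_le`.  Nothing restated.

WHAT IS DECLARED ∕ PROVED (kernel, 0 sorry; four small definitions with bodies + theorems; no `instance`, no `notation`).
* §1 `bsize β w := √(β w w)`, `bsize_sq ∕ _nonneg ∕ _smul ∕ _add_le ∕ _sum_le ∕ _zero`, `abs_le_bsize_mul_bsize` (Cauchy–Schwarz).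
* §2 `cform β π s v w := Σ_{i∈s} β(π_i v, π_i w)`, `cform_self_eq_sum_sq`, `bsize_coord_le` (`|π_x v| ≤ √cform(v,v)`, `x ∈ s`), ★ `abs_cform_le` (Cauchy–Schwarz),
  `cform_sigma_self` (`cform(σ_y w, σ_y w) = β(w,w)`).
* §3 `scaleV π σ s ω v := Σ_{i∈s} ω_i • σ_i(π_i v)` (conjugation weights), `coord_scaleV`, `scaleV_scaleV`, `scaleV_one`, `scaleV_sigma`; `blk π σ T i j w := π_i(T(σ_j w))`,
  `blk_smul`, ★ `coord_apply_eq_sum_blk` (`π_x(Tv) = Σ_{j∈s} T_{xj} π_j v`), `coord_apply_scaleV_eq_sum_blk`.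
* §4 ★★ `abs_cform_conj_sub_le_of_rowcol` — THE SCHUR BOUND OF THE CONJUGATION ERROR from `(e^{κ·dist} − 1)`-weighted ROW AND COLUMN SUMS `≤ ϱ` of a block majorant
  `|T_{xy}w| ≤ A(x,y)|w|`; `rowcol_of_range` (a finite range `r`, block bound `a`, ball count `N` give row∕column sums `≤ aN(e^{κr} − 1)`).
* §5 ★★ `bijective_of_coercive'` (definite `β`, finite-dimensional `V`, `π_i v = 0 ∀ i ⟹ v = 0`) and ★★★ `bsize_coord_le_exp_of_coercive_of_rowcol` — THE
  COMBES–THOMAS BOUND: pseudo-metric `dist`, `c`-coercive `T`, majorant with row∕column sums `≤ ϱ < c` ⟹ `Tg = σ_y w` (`y ∈ s`) gives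
  `|π_x g| ≤ e^{−κ·dist(x,y)}·|w| ∕ (c − ϱ)` for `x ∈ s`; ★★ `…_of_range` (finite-range corollary).

HONEST SCOPE.  [folklore] finite-dimensional linear algebra; no estimate of [B9]; `c`, the majorant and the metric are hypotheses; the rate is the window's, not
print's.  Count-neutral; N05 ∕ N06 NOT discharged; K1⁸ `stmt-QuantumFields-26907` NOT closed; one finite `𝕋⁴` programme at fixed `ε`, Bałaban as printed; R4
closes only the conditional finite-`𝕋⁴` rung `BalabanLadder.UV` — nothing continuum ∕ ℝ⁴ ∕ OS ∕ mass gap ∕ Clay.  Unit `pub-ymgap-dag-n06-w2` (g4), 2026-08-28.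
-/

noncomputable section

open scoped BigOperators

namespace Literature.MathematicalPhysics.QuantumFieldTheory.Balaban1983to89.B9Eq342CombesThomasBlockForm

open B9Eq342CombesThomasFormZd (abs_bilin_le_sqrt_mul_sqrt abs_exp_weight_sub_one_le abs_dist_sub_dist_le)

variable {ι : Type*} {V : Type*} [AddCommGroup V] [Module ℝ V] {F : Type*} [AddCommGroup F] [Module ℝ F]

/-! ## §1  The fibre size `|w| = √β(w,w)` -/

section Fibre

variable (β : LinearMap.BilinForm ℝ F)

/-- **THE FIBRE SIZE** `|w|_β := √β(w, w)` (print's `|X| = (tr X*X)^{1/2}` for `β = Re τ(a*b)`). [cite: Balaban1985BackgroundPropagators, p.390 («|X|² = tr X*X»)] -/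
def bsize (w : F) : ℝ := Real.sqrt (β w w)

/-- `0 ≤ |w|_β`. [cite: Balaban1985BackgroundPropagators, p.390 (bookkeeping)] -/
theorem bsize_nonneg (w : F) : 0 ≤ bsize β w := Real.sqrt_nonneg _

variable {β}

/-- `|w|_β² = β(w,w)` for a non-negative form. [cite: Balaban1985BackgroundPropagators, p.390 (bookkeeping)] -/
theorem bsize_sq (hβ0 : ∀ v, 0 ≤ β v v) (w : F) : bsize β w ^ 2 = β w w := Real.sq_sqrt (hβ0 w)

/-- `|0|_β = 0`. [cite: Balaban1985BackgroundPropagators, p.390 (bookkeeping)] -/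
theorem bsize_zero : bsize β (0 : F) = 0 := by simp [bsize]

/-- `|c • w|_β = |c|·|w|_β`. [cite: Balaban1985BackgroundPropagators, p.390 (bookkeeping)] -/
theorem bsize_smul (c : ℝ) (w : F) : bsize β (c • w) = |c| * bsize β w := by
  have h : β (c • w) (c • w) = c ^ 2 * β w w := by
    simp only [map_smul, LinearMap.smul_apply, smul_eq_mul]; ring
  rw [bsize, h, Real.sqrt_mul (sq_nonneg c), Real.sqrt_sq_eq_abs, bsize]

/-- ★ **CAUCHY–SCHWARZ** `|β(u,v)| ≤ |u|_β·|v|_β` (symmetric, non-negative `β`). [cite: Balaban1985BackgroundPropagators, p.391 («natural L² scalar products»)] -/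
theorem abs_le_bsize_mul_bsize (hβs : ∀ u v, β u v = β v u) (hβ0 : ∀ v, 0 ≤ β v v) (u v : F) : |β u v| ≤ bsize β u * bsize β v :=
  abs_bilin_le_sqrt_mul_sqrt β hβs hβ0 u v

/-- **TRIANGLE INEQUALITY** `|u + v|_β ≤ |u|_β + |v|_β`. [cite: Balaban1985BackgroundPropagators, p.390 (bookkeeping)] -/
theorem bsize_add_le (hβs : ∀ u v, β u v = β v u) (hβ0 : ∀ v, 0 ≤ β v v) (u v : F) : bsize β (u + v) ≤ bsize β u + bsize β v := by
  have huv := abs_le_bsize_mul_bsize hβs hβ0 u v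
  have hexp : β (u + v) (u + v) = β u u + 2 * β u v + β v v := by
    simp only [map_add, LinearMap.add_apply, hβs v u]; ring
  rw [bsize, Real.sqrt_le_left (add_nonneg (bsize_nonneg β u) (bsize_nonneg β v)), hexp, add_sq, bsize_sq hβ0, bsize_sq hβ0]
  nlinarith [huv, le_abs_self (β u v)]

/-- `|Σ_i g_i|_β ≤ Σ_i |g_i|_β`. [cite: Balaban1985BackgroundPropagators, p.390 (bookkeeping)] -/
theorem bsize_sum_le (hβs : ∀ u v, β u v = β v u) (hβ0 : ∀ v, 0 ≤ β v v) {κ : Type*} (S : Finset κ) (g : κ → F) :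
    bsize β (∑ i ∈ S, g i) ≤ ∑ i ∈ S, bsize β (g i) := by
  classical
  induction S using Finset.induction_on with
  | empty => rw [Finset.sum_empty, Finset.sum_empty, bsize_zero]
  | insert i S hi ih =>
    rw [Finset.sum_insert hi, Finset.sum_insert hi]
    exact (bsize_add_le hβs hβ0 _ _).trans (by linarith)

/-- `|w|_β = 0 ↔ w = 0` for a DEFINITE form. [cite: Balaban1985BackgroundPropagators, p.390 (bookkeeping)] -/
theorem bsize_eq_zero_iff (hβ0 : ∀ v, 0 ≤ β v v) (hβd : ∀ v, β v v = 0 → v = 0) (w : F) : bsize β w = 0 ↔ w = 0 := by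
  constructor
  · intro h
    have h2 := bsize_sq hβ0 w
    rw [h, sq, zero_mul] at h2
    exact hβd w h2.symm
  · intro h; rw [h, bsize_zero]

end Fibre

/-! ## §2  The carrier form `Σ_{i∈s} β(π_i v, π_i w)` -/

section Carrier

variable (β : LinearMap.BilinForm ℝ F) (π : ι → V →ₗ[ℝ] F) (s : Finset ι)

/-- **THE CARRIER FORM READ THROUGH THE COORDINATES**: `⟨v, w⟩ := Σ_{i∈s} β(π_i v, π_i w)` (`formE` ∕ `levForm` ∕ `bondPair` of the `ℤᵈ` frame are of this shape).
[cite: Balaban1985BackgroundPropagators, (3.21) p.394 («L²(Ω₀, 𝔤)»), (3.17) p.393, p.391] -/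
def cform (v w : V) : ℝ := ∑ i ∈ s, β (π i v) (π i w)

variable {β π s}

/-- `⟨v,v⟩ = Σ_{i∈s} |π_i v|²`. [cite: Balaban1985BackgroundPropagators, (3.21) p.394 (bookkeeping)] -/
theorem cform_self_eq_sum_sq (hβ0 : ∀ v, 0 ≤ β v v) (v : V) : cform β π s v v = ∑ i ∈ s, bsize β (π i v) ^ 2 :=
  Finset.sum_congr rfl fun _ _ => (bsize_sq hβ0 _).symm

/-- `0 ≤ ⟨v,v⟩`. [cite: Balaban1985BackgroundPropagators, (3.21) p.394 (bookkeeping)] -/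
theorem cform_self_nonneg (hβ0 : ∀ v, 0 ≤ β v v) (v : V) : 0 ≤ cform β π s v v := by
  rw [cform_self_eq_sum_sq hβ0]; exact Finset.sum_nonneg fun i _ => sq_nonneg _

/-- `⟨·,·⟩` is symmetric. [cite: Balaban1985BackgroundPropagators, p.391 (bookkeeping)] -/
theorem cform_comm (hβs : ∀ u v, β u v = β v u) (v w : V) : cform β π s v w = cform β π s w v :=
  Finset.sum_congr rfl fun _ _ => hβs _ _

/-- `⟨·,·⟩` is additive and homogeneous in the second slot (bookkeeping for Cauchy–Schwarz). [cite: Balaban1985BackgroundPropagators, p.391 (bookkeeping)] -/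
theorem cform_add_right (u v w : V) : cform β π s u (v + w) = cform β π s u v + cform β π s u w := by
  simp only [cform, map_add, ← Finset.sum_add_distrib]

/-- homogeneity in the second slot. [cite: Balaban1985BackgroundPropagators, p.391 (bookkeeping)] -/
theorem cform_smul_right (c : ℝ) (u v : V) : cform β π s u (c • v) = c * cform β π s u v := by
  simp only [cform, map_smul, smul_eq_mul, Finset.mul_sum]

/-- **POINTWISE BOUND** `|π_x v|_β ≤ √⟨v,v⟩` for `x ∈ s`. [cite: Balaban1985BackgroundPropagators, (3.21) p.394 (bookkeeping)] -/
theorem bsize_coord_le (hβ0 : ∀ v, 0 ≤ β v v) (v : V) {x : ι} (hx : x ∈ s) : bsize β (π x v) ≤ Real.sqrt (cform β π s v v) := by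
  rw [Real.le_sqrt (bsize_nonneg β _) (cform_self_nonneg hβ0 v), cform_self_eq_sum_sq hβ0]
  exact Finset.single_le_sum (f := fun i => bsize β (π i v) ^ 2) (fun i _ => sq_nonneg _) hx

/-- ★ **CAUCHY–SCHWARZ FOR THE CARRIER FORM**: `|⟨v,w⟩| ≤ √⟨v,v⟩·√⟨w,w⟩`. [cite: Balaban1985BackgroundPropagators, p.391 («natural L² scalar products»)] -/
theorem abs_cform_le (hβs : ∀ u v, β u v = β v u) (hβ0 : ∀ v, 0 ≤ β v v) (v w : V) :
    |cform β π s v w| ≤ Real.sqrt (cform β π s v v) * Real.sqrt (cform β π s w w) := by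
  -- termwise Cauchy–Schwarz in the fibre, then the discrete Cauchy–Schwarz
  have h1 : |cform β π s v w| ≤ ∑ i ∈ s, bsize β (π i v) * bsize β (π i w) :=
    (Finset.abs_sum_le_sum_abs _ _).trans (Finset.sum_le_sum fun i _ => abs_le_bsize_mul_bsize hβs hβ0 _ _)
  have h2 := Real.sum_mul_le_sqrt_mul_sqrt s (fun i => bsize β (π i v)) (fun i => bsize β (π i w))
  rw [cform_self_eq_sum_sq hβ0, cform_self_eq_sum_sq hβ0]
  exact h1.trans h2

variable (σ : ι → F →ₗ[ℝ] V)

/-- `⟨σ_y w, σ_y w⟩ = |w|²_β` for `y ∈ s` (`π_i σ_j = δ_{ij}`). [cite: Balaban1985BackgroundPropagators, (3.21) p.394 (bookkeeping)] -/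
theorem cform_sigma_self (hβ0 : ∀ v, 0 ≤ β v v) (hππ : ∀ i ∈ s, ∀ w : F, π i (σ i w) = w)
    (hπ0 : ∀ i ∈ s, ∀ j ∈ s, i ≠ j → ∀ w : F, π i (σ j w) = 0)
    {y : ι} (hy : y ∈ s) (w : F) : cform β π s (σ y w) (σ y w) = bsize β w ^ 2 := by
  classical
  rw [cform_self_eq_sum_sq hβ0, Finset.sum_eq_single_of_mem y hy]
  · rw [hππ y hy]
  · intro i hi hiy
    rw [hπ0 i hi y hy hiy, bsize_zero, sq, zero_mul]

end Carrier

/-! ## §3  Conjugation weights and the blocks `T_{ij} = π_i T σ_j` -/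

section Blocks

variable (π : ι → V →ₗ[ℝ] F) (σ : ι → F →ₗ[ℝ] V) (s : Finset ι)

/-- **MULTIPLICATION BY A REAL WEIGHT `ω` IN THE COORDINATES**: `ω·v := Σ_{i∈s} ω_i • σ_i(π_i v)` (the conjugation `e^{±κρ}`).
[cite: Balaban1988RG2Cluster, (2.7) p.13; Balaban1985BackgroundPropagators, (3.42) p.397] -/
def scaleV (ω : ι → ℝ) (v : V) : V := ∑ i ∈ s, ω i • σ i (π i v)

/-- **THE `(i, j)` BLOCK OF `T` APPLIED TO `w`**: `T_{ij}w := π_i(T(σ_j w))`. [cite: Balaban1985BackgroundPropagators, (3.42) p.397 (the kernel of an operator)] -/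
def blk (T : V →ₗ[ℝ] V) (i j : ι) (w : F) : F := π i (T (σ j w))

variable {π σ s}
variable (hrec : ∀ v : V, ∑ i ∈ s, σ i (π i v) = v)
  (hππ : ∀ i ∈ s, ∀ w : F, π i (σ i w) = w) (hπ0 : ∀ i ∈ s, ∀ j ∈ s, i ≠ j → ∀ w : F, π i (σ j w) = 0)

include hππ hπ0 in
/-- the coordinates of a scaled vector: `π_x(ω·v) = ω_x • π_x v` for `x ∈ s`. [cite: Balaban1988RG2Cluster, (2.7) p.13 (bookkeeping)] -/
theorem coord_scaleV (ω : ι → ℝ) (v : V) {x : ι} (hx : x ∈ s) : π x (scaleV π σ s ω v) = ω x • π x v := by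
  classical
  rw [scaleV, map_sum, Finset.sum_eq_single_of_mem x hx]
  · rw [map_smul, hππ x hx]
  · intro i hi hix
    rw [map_smul, hπ0 x hx i hi (Ne.symm hix), smul_zero]

include hππ hπ0 in
/-- two scalings compose: `ω·(ω′·v) = (ωω′)·v`. [cite: Balaban1988RG2Cluster, (2.7) p.13 (bookkeeping)] -/
theorem scaleV_scaleV (ω ω' : ι → ℝ) (v : V) : scaleV π σ s ω (scaleV π σ s ω' v) = scaleV π σ s (fun i => ω i * ω' i) v := by
  unfold scaleV
  refine Finset.sum_congr rfl fun i hi => ?_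
  have h := coord_scaleV hππ hπ0 ω' v hi
  unfold scaleV at h
  rw [h, map_smul, smul_smul]

include hrec in
/-- `1·v = v`. [cite: Balaban1988RG2Cluster, (2.7) p.13 (bookkeeping)] -/
theorem scaleV_one (v : V) : scaleV π σ s (fun _ => (1 : ℝ)) v = v := by
  simp only [scaleV, one_smul]; exact hrec v

include hππ hπ0 in
/-- scaling a single-site vector: `ω·(σ_y w) = ω_y • σ_y w` (`y ∈ s`). [cite: Balaban1988RG2Cluster, (2.7) p.13 (bookkeeping)] -/
theorem scaleV_sigma (ω : ι → ℝ) {y : ι} (hy : y ∈ s) (w : F) : scaleV π σ s ω (σ y w) = ω y • σ y w := by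
  classical
  rw [scaleV, Finset.sum_eq_single_of_mem y hy]
  · rw [hππ y hy]
  · intro i hi hiy
    rw [hπ0 i hi y hy hiy, map_zero, smul_zero]

variable (T : V →ₗ[ℝ] V)

/-- the block is ℝ-linear in `w`. [cite: Balaban1985BackgroundPropagators, (3.42) p.397 (bookkeeping)] -/
theorem blk_smul (i j : ι) (c : ℝ) (w : F) : blk π σ T i j (c • w) = c • blk π σ T i j w := by
  rw [blk, blk, map_smul, map_smul, map_smul]

include hrec in
/-- ★ **FIELD-LINEARITY READ THROUGH THE COORDINATES**: `π_x(Tv) = Σ_{j∈s} T_{xj}(π_j v)`. [cite: Balaban1985BackgroundPropagators, (3.42) p.397, (3.24) p.394] -/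
theorem coord_apply_eq_sum_blk (v : V) (x : ι) : π x (T v) = ∑ j ∈ s, blk π σ T x j (π j v) := by
  conv_lhs => rw [← hrec v]
  rw [map_sum, map_sum]
  rfl

include hrec hππ hπ0 in
/-- the same for a scaled vector: `π_x(T(ω·v)) = Σ_{j∈s} ω_j • T_{xj}(π_j v)`. [cite: Balaban1988RG2Cluster, (2.7) p.13 (bookkeeping)] -/
theorem coord_apply_scaleV_eq_sum_blk (ω : ι → ℝ) (v : V) (x : ι) :
    π x (T (scaleV π σ s ω v)) = ∑ j ∈ s, ω j • blk π σ T x j (π j v) := by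
  rw [coord_apply_eq_sum_blk hrec T]
  exact Finset.sum_congr rfl fun j hj => by rw [coord_scaleV hππ hπ0 ω v hj, blk_smul]

end Blocks

/-! ## §4  The Schur bound of the conjugation error from weighted row and column sums -/

section Schur

variable {β : LinearMap.BilinForm ℝ F} {π : ι → V →ₗ[ℝ] F} {σ : ι → F →ₗ[ℝ] V} {s : Finset ι} {T : V →ₗ[ℝ] V}

/-- ★★ **THE SCHUR BOUND OF THE CONJUGATION ERROR** (carrier-generic, almost-local form): for a weight `ρ` 1-Lipschitz w.r.t. `dist`, a block majorant
`|T_{xy}w|_β ≤ A(x,y)|w|_β` on `s × s` whose `(e^{κ·dist} − 1)`-weighted row and column sums are `≤ ϱ`, and `κ ≥ 0`: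
`|⟨v, e^{κρ}·T(e^{−κρ}·v)⟩ − ⟨v, Tv⟩| ≤ ϱ·⟨v,v⟩`. [cite: Balaban1988RG2Cluster, (2.7) p.13, p.15, (2.16) p.16; Balaban1985BackgroundPropagators, (3.42) p.397] -/
theorem abs_cform_conj_sub_le_of_rowcol (hβs : ∀ u v, β u v = β v u) (hβ0 : ∀ v, 0 ≤ β v v)
    (hrec : ∀ v : V, ∑ i ∈ s, σ i (π i v) = v) (hππ : ∀ i ∈ s, ∀ w : F, π i (σ i w) = w)
    (hπ0 : ∀ i ∈ s, ∀ j ∈ s, i ≠ j → ∀ w : F, π i (σ j w) = 0)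
    {dist : ι → ι → ℝ} {ρ : ι → ℝ} (hρ : ∀ x y, |ρ x - ρ y| ≤ dist x y) {κ ϱ : ℝ} (hκ : 0 ≤ κ)
    (A : ι → ι → ℝ) (hA : ∀ x y, 0 ≤ A x y)
    (hblock : ∀ x ∈ s, ∀ y ∈ s, ∀ w : F, bsize β (blk π σ T x y w) ≤ A x y * bsize β w)
    (hrow : ∀ x ∈ s, ∑ y ∈ s, A x y * (Real.exp (κ * dist x y) - 1) ≤ ϱ)
    (hcol : ∀ y ∈ s, ∑ x ∈ s, A x y * (Real.exp (κ * dist x y) - 1) ≤ ϱ) (v : V) :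
    |cform β π s v (scaleV π σ s (fun x => Real.exp (κ * ρ x)) (T (scaleV π σ s (fun x => Real.exp (-(κ * ρ x))) v))) - cform β π s v (T v)| ≤
      ϱ * cform β π s v v := by
  classical
  set P : ι → F := fun i => π i v with hP
  set B : ι → ι → ℝ := fun x y => β (P x) (blk π σ T x y (P y)) with hB
  set K : ι → ι → ℝ := fun x y => A x y * (Real.exp (κ * dist x y) - 1) with hK
  have hconj : cform β π s v (scaleV π σ s (fun x => Real.exp (κ * ρ x)) (T (scaleV π σ s (fun x => Real.exp (-(κ * ρ x))) v))) =
      ∑ x ∈ s, ∑ y ∈ s, Real.exp (κ * (ρ x - ρ y)) * B x y := by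
    unfold cform
    refine Finset.sum_congr rfl fun x hx => ?_
    rw [coord_scaleV hππ hπ0 _ _ hx, coord_apply_scaleV_eq_sum_blk hrec hππ hπ0 T, Finset.smul_sum, map_sum]
    refine Finset.sum_congr rfl fun y _ => ?_
    rw [smul_smul, ← Real.exp_add, show κ * ρ x + -(κ * ρ y) = κ * (ρ x - ρ y) by ring, map_smul, smul_eq_mul]
  have hplain : cform β π s v (T v) = ∑ x ∈ s, ∑ y ∈ s, B x y := by
    unfold cform
    refine Finset.sum_congr rfl fun x _ => ?_
    rw [coord_apply_eq_sum_blk hrec T, map_sum]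
  have hwt : ∀ x y, |Real.exp (κ * (ρ x - ρ y)) - 1| ≤ Real.exp (κ * dist x y) - 1 := fun x y =>
    abs_exp_weight_sub_one_le hκ (hρ x y) le_rfl
  have hKnn : ∀ x y, 0 ≤ K x y := fun x y =>
    mul_nonneg (hA x y) (by linarith [abs_nonneg (Real.exp (κ * (ρ x - ρ y)) - 1), hwt x y])
  have hterm : ∀ x ∈ s, ∀ y ∈ s, |Real.exp (κ * (ρ x - ρ y)) * B x y - B x y| ≤ K x y * (bsize β (P x) * bsize β (P y)) := by
    intro x hx y hy
    rw [show Real.exp (κ * (ρ x - ρ y)) * B x y - B x y = (Real.exp (κ * (ρ x - ρ y)) - 1) * B x y by ring, abs_mul]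
    have hBle : |B x y| ≤ A x y * (bsize β (P x) * bsize β (P y)) := by
      calc |B x y| ≤ bsize β (P x) * bsize β (blk π σ T x y (P y)) := abs_le_bsize_mul_bsize hβs hβ0 _ _
        _ ≤ bsize β (P x) * (A x y * bsize β (P y)) := mul_le_mul_of_nonneg_left (hblock x hx y hy _) (bsize_nonneg β _)
        _ = A x y * (bsize β (P x) * bsize β (P y)) := by ring
    calc |Real.exp (κ * (ρ x - ρ y)) - 1| * |B x y| ≤ (Real.exp (κ * dist x y) - 1) * (A x y * (bsize β (P x) * bsize β (P y))) :=
          mul_le_mul (hwt x y) hBle (abs_nonneg _) (by linarith [abs_nonneg (Real.exp (κ * (ρ x - ρ y)) - 1), hwt x y])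
      _ = K x y * (bsize β (P x) * bsize β (P y)) := by rw [hK]; ring
  have hamgm : ∀ x ∈ s, ∀ y ∈ s, K x y * (bsize β (P x) * bsize β (P y)) ≤ K x y * (bsize β (P x) ^ 2 / 2) + K x y * (bsize β (P y) ^ 2 / 2) := by
    intro x _ y _
    have := hKnn x y
    nlinarith [sq_nonneg (bsize β (P x) - bsize β (P y))]
  rw [hconj, hplain, ← Finset.sum_sub_distrib]
  calc |∑ x ∈ s, (∑ y ∈ s, Real.exp (κ * (ρ x - ρ y)) * B x y - ∑ y ∈ s, B x y)|
      ≤ ∑ x ∈ s, |∑ y ∈ s, Real.exp (κ * (ρ x - ρ y)) * B x y - ∑ y ∈ s, B x y| := Finset.abs_sum_le_sum_abs _ _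
    _ ≤ ∑ x ∈ s, ∑ y ∈ s, |Real.exp (κ * (ρ x - ρ y)) * B x y - B x y| := Finset.sum_le_sum fun x _ => by
        rw [← Finset.sum_sub_distrib]; exact Finset.abs_sum_le_sum_abs _ _
    _ ≤ ∑ x ∈ s, ∑ y ∈ s, (K x y * (bsize β (P x) ^ 2 / 2) + K x y * (bsize β (P y) ^ 2 / 2)) :=
        Finset.sum_le_sum fun x hx => Finset.sum_le_sum fun y hy => (hterm x hx y hy).trans (hamgm x hx y hy)
    _ = (∑ x ∈ s, ∑ y ∈ s, K x y * (bsize β (P x) ^ 2 / 2)) + ∑ x ∈ s, ∑ y ∈ s, K x y * (bsize β (P y) ^ 2 / 2) := by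
        rw [← Finset.sum_add_distrib]; exact Finset.sum_congr rfl fun x _ => Finset.sum_add_distrib
    _ = (∑ x ∈ s, (bsize β (P x) ^ 2 / 2) * ∑ y ∈ s, K x y) + ∑ y ∈ s, (bsize β (P y) ^ 2 / 2) * ∑ x ∈ s, K x y := by
        congr 1
        · exact Finset.sum_congr rfl fun x _ => by rw [Finset.mul_sum]; exact Finset.sum_congr rfl fun y _ => by ring
        · rw [Finset.sum_comm]; exact Finset.sum_congr rfl fun y _ => by rw [Finset.mul_sum]; exact Finset.sum_congr rfl fun x _ => by ring
    _ ≤ ∑ x ∈ s, (bsize β (P x) ^ 2 / 2) * ϱ + ∑ y ∈ s, (bsize β (P y) ^ 2 / 2) * ϱ :=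
        add_le_add (Finset.sum_le_sum fun x hx => mul_le_mul_of_nonneg_left (hrow x hx) (by positivity))
          (Finset.sum_le_sum fun y hy => mul_le_mul_of_nonneg_left (hcol y hy) (by positivity))
    _ = ϱ * cform β π s v v := by
        rw [cform_self_eq_sum_sq hβ0, ← Finset.sum_add_distrib, Finset.mul_sum]
        exact Finset.sum_congr rfl fun x _ => by ring

/-- **A FINITE RANGE IS AN INSTANCE OF THE ROW∕COLUMN HYPOTHESIS**: the majorant `A(x,y) := a·𝟙[dist(x,y) ≤ r]` of a range-`r` operator with block bound `a ≥ 0`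
and ball count `#{y ∈ s : dist(x,y) ≤ r} ≤ N` has `(e^{κ·dist} − 1)`-weighted row sums `≤ aN(e^{κr} − 1)` (`κ, r ≥ 0`).
[cite: Balaban1988RG2Cluster, (2.16) p.16 (bookkeeping); Balaban1985BackgroundPropagators, (3.42) p.397] -/
theorem rowsum_of_range {dist : ι → ι → ℝ} {r a κ : ℝ} {N : ℕ} (hr : 0 ≤ r) (ha : 0 ≤ a) (hκ : 0 ≤ κ) {x : ι}
    (hN : (s.filter (fun y => dist x y ≤ r)).card ≤ N) :
    ∑ y ∈ s, (if dist x y ≤ r then a else 0) * (Real.exp (κ * dist x y) - 1) ≤ a * N * (Real.exp (κ * r) - 1) := by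
  classical
  have hterm : ∀ y ∈ s, (if dist x y ≤ r then a else 0) * (Real.exp (κ * dist x y) - 1) ≤
      if dist x y ≤ r then a * (Real.exp (κ * r) - 1) else 0 := by
    intro y _
    split_ifs with h
    · refine mul_le_mul_of_nonneg_left ?_ ha
      linarith [Real.exp_le_exp.mpr (mul_le_mul_of_nonneg_left h hκ)]
    · rw [zero_mul]
  refine (Finset.sum_le_sum hterm).trans ?_
  rw [← Finset.sum_filter, Finset.sum_const, nsmul_eq_mul]
  have hexp : 0 ≤ Real.exp (κ * r) - 1 := by linarith [Real.one_le_exp (mul_nonneg hκ hr)]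
  calc ((s.filter (fun y => dist x y ≤ r)).card : ℝ) * (a * (Real.exp (κ * r) - 1)) ≤ (N : ℝ) * (a * (Real.exp (κ * r) - 1)) :=
        mul_le_mul_of_nonneg_right (by exact_mod_cast hN) (mul_nonneg ha hexp)
    _ = a * N * (Real.exp (κ * r) - 1) := by ring

end Schur

/-! ## §5  Coercive ⟹ bijective; the Combes–Thomas bound -/

section CombesThomas

variable {β : LinearMap.BilinForm ℝ F} {π : ι → V →ₗ[ℝ] F} {σ : ι → F →ₗ[ℝ] V} {s : Finset ι} {T : V →ₗ[ℝ] V}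

/-- ★★ **COERCIVE ⟹ BIJECTIVE** (finite-dimensional `V`, definite `β`, the coordinates separate points): `c > 0`, `c⟨v,v⟩ ≤ ⟨v,Tv⟩` ⟹ `T` bijective.
[cite: Balaban1984PropagatorsII, p.226; Balaban1985BackgroundPropagators, Thm 3.11 p.416] -/
theorem bijective_of_coercive' [FiniteDimensional ℝ V] (hβ0 : ∀ v, 0 ≤ β v v) (hβd : ∀ v, β v v = 0 → v = 0)
    (hsep : ∀ v : V, (∀ i ∈ s, π i v = 0) → v = 0) {c : ℝ} (hc : 0 < c)
    (hco : ∀ v : V, c * cform β π s v v ≤ cform β π s v (T v)) : Function.Bijective T := by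
  have hinj : Function.Injective T := by
    rw [← LinearMap.ker_eq_bot, Submodule.eq_bot_iff]
    intro v hv
    rw [LinearMap.mem_ker] at hv
    have h1 := hco v
    rw [hv] at h1
    have h0 : cform β π s v 0 = 0 := by simp [cform]
    rw [h0] at h1
    have h2 := cform_self_nonneg (π := π) (s := s) hβ0 v
    have h3 : cform β π s v v = 0 := by nlinarith
    rw [cform_self_eq_sum_sq hβ0] at h3
    refine hsep v fun i hi => ?_
    have h4 := (Finset.sum_eq_zero_iff_of_nonneg fun j _ => sq_nonneg (bsize β (π j v))).1 h3 i hi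
    exact (bsize_eq_zero_iff hβ0 hβd _).1 (pow_eq_zero_iff two_ne_zero |>.1 h4)
  exact ⟨hinj, LinearMap.injective_iff_surjective.1 hinj⟩

/-- ★★★ **THE COMBES–THOMAS BOUND, CARRIER-GENERIC.**  `dist` a pseudo-metric on the index set; `T` an ℝ-linear operator of `V`, `c`-COERCIVE for the carrier
form (`c⟨v,v⟩ ≤ ⟨v,Tv⟩`); a block majorant `|T_{xy}w|_β ≤ A(x,y)|w|_β` on `s × s` with `(e^{κ·dist} − 1)`-weighted row and column sums `≤ ϱ < c` (`κ ≥ 0`).  Then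
every solution of `Tg = σ_y w` (`y ∈ s`) satisfies `|π_x g|_β ≤ e^{−κ·dist(x,y)}·|w|_β ∕ (c − ϱ)` for every `x ∈ s` — the n = 0 shape of (3.42) for the kernel of
`T⁻¹`, constants independent of `|s|`.  PROOF: `g_κ := e^{κ dist(·,y)}·g`; the conjugate maps `g_κ` to `σ_y w`; coercivity + the Schur bound give
`(c − ϱ)⟨g_κ,g_κ⟩ ≤ ⟨g_κ, σ_y w⟩ ≤ |g_κ|·|w|_β`; read the `x`-coordinate.
[cite: Balaban1985BackgroundPropagators, (3.42) p.397, Thm 3.1 p.397, Thm 3.3 p.399, Thm 3.11 p.416; Balaban1984PropagatorsII, p.226; Balaban1988RG2Cluster, (2.5)–(2.7) pp.12–13] -/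
theorem bsize_coord_le_exp_of_coercive_of_rowcol (hβs : ∀ u v, β u v = β v u) (hβ0 : ∀ v, 0 ≤ β v v)
    (hrec : ∀ v : V, ∑ i ∈ s, σ i (π i v) = v) (hππ : ∀ i ∈ s, ∀ w : F, π i (σ i w) = w)
    (hπ0 : ∀ i ∈ s, ∀ j ∈ s, i ≠ j → ∀ w : F, π i (σ j w) = 0)
    {dist : ι → ι → ℝ} (hd0 : ∀ x, dist x x = 0) (hds : ∀ x y, dist x y = dist y x) (hdt : ∀ x y z, dist x z ≤ dist x y + dist y z)
    {c κ ϱ : ℝ} (hκ : 0 ≤ κ) (A : ι → ι → ℝ) (hA : ∀ x y, 0 ≤ A x y)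
    (hblock : ∀ x ∈ s, ∀ y ∈ s, ∀ w : F, bsize β (blk π σ T x y w) ≤ A x y * bsize β w)
    (hrow : ∀ x ∈ s, ∑ y ∈ s, A x y * (Real.exp (κ * dist x y) - 1) ≤ ϱ)
    (hcol : ∀ y ∈ s, ∑ x ∈ s, A x y * (Real.exp (κ * dist x y) - 1) ≤ ϱ)
    (hco : ∀ v : V, c * cform β π s v v ≤ cform β π s v (T v)) (hϱ : ϱ < c)
    {g : V} {y : ι} (hy : y ∈ s) {w : F} (hg : T g = σ y w) {x : ι} (hx : x ∈ s) :
    bsize β (π x g) ≤ Real.exp (-(κ * dist x y)) / (c - ϱ) * bsize β w := by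
  -- `dist : ι → ι → ℝ` on an arbitrary index type: the Lipschitz lemma of FILE A is stated for sites, so redo its two lines here
  set ρ : ι → ℝ := fun z => dist z y with hρ
  have hρL : ∀ z z', |ρ z - ρ z'| ≤ dist z z' := by
    intro z z'
    rw [abs_sub_le_iff]
    constructor
    · have := hdt z z' y; simp only [hρ]; linarith
    · have := hdt z' z y; rw [hds z' z] at this; simp only [hρ]; linarith
  set gκ : V := scaleV π σ s (fun z => Real.exp (κ * ρ z)) g with hgκ
  have hunscale : scaleV π σ s (fun z => Real.exp (-(κ * ρ z))) gκ = g := by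
    rw [hgκ, scaleV_scaleV hππ hπ0]
    have h1 : (fun i => Real.exp (-(κ * ρ i)) * Real.exp (κ * ρ i)) = fun _ => (1 : ℝ) := by
      funext i; rw [← Real.exp_add, neg_add_cancel, Real.exp_zero]
    rw [h1, scaleV_one hrec]
  have hconj : scaleV π σ s (fun z => Real.exp (κ * ρ z)) (T (scaleV π σ s (fun z => Real.exp (-(κ * ρ z))) gκ)) = σ y w := by
    rw [hunscale, hg, scaleV_sigma hππ hπ0 _ hy]
    simp only [hρ, hd0 y, mul_zero, Real.exp_zero, one_smul]
  have hschur := abs_cform_conj_sub_le_of_rowcol (T := T) hβs hβ0 hrec hππ hπ0 hρL hκ A hA hblock hrow hcol gκ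
  rw [hconj] at hschur
  have hcoer := hco gκ
  have hlow : (c - ϱ) * cform β π s gκ gκ ≤ cform β π s gκ (σ y w) := by
    have h := (abs_sub_le_iff.1 hschur).2
    nlinarith [h, hcoer]
  have hcs := (le_abs_self _).trans (abs_cform_le (π := π) (s := s) hβs hβ0 gκ (σ y w))
  rw [cform_sigma_self σ hβ0 hππ hπ0 hy, Real.sqrt_sq (bsize_nonneg β w)] at hcs
  set X := Real.sqrt (cform β π s gκ gκ) with hX
  have hX0 : 0 ≤ X := Real.sqrt_nonneg _
  have hXsq : X ^ 2 = cform β π s gκ gκ := Real.sq_sqrt (cform_self_nonneg hβ0 gκ)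
  have hcϱ : 0 < c - ϱ := by linarith
  have hXle : (c - ϱ) * X ≤ bsize β w := by
    have h1 : (c - ϱ) * X ^ 2 ≤ X * bsize β w := by rw [hXsq]; exact hlow.trans hcs
    by_cases hX0' : X = 0
    · rw [hX0', mul_zero]; exact bsize_nonneg β w
    · have hXpos : 0 < X := lt_of_le_of_ne hX0 (Ne.symm hX0')
      nlinarith
  have hpt : bsize β (π x gκ) ≤ X := bsize_coord_le hβ0 gκ hx
  rw [hgκ, coord_scaleV hππ hπ0 _ _ hx, bsize_smul, abs_of_pos (Real.exp_pos _)] at hpt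
  have hexp : 0 < Real.exp (κ * dist x y) := Real.exp_pos _
  rw [Real.exp_neg, div_eq_mul_inv, mul_assoc]
  rw [show Real.exp (κ * ρ x) = Real.exp (κ * dist x y) by rfl] at hpt
  calc bsize β (π x g) = (Real.exp (κ * dist x y))⁻¹ * (Real.exp (κ * dist x y) * bsize β (π x g)) := by
        rw [← mul_assoc, inv_mul_cancel₀ hexp.ne', one_mul]
    _ ≤ (Real.exp (κ * dist x y))⁻¹ * X := mul_le_mul_of_nonneg_left hpt (inv_nonneg.2 hexp.le)
    _ ≤ (Real.exp (κ * dist x y))⁻¹ * ((c - ϱ)⁻¹ * bsize β w) := by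
        refine mul_le_mul_of_nonneg_left ?_ (inv_nonneg.2 hexp.le)
        rw [le_inv_mul_iff₀ hcϱ]
        exact hXle

/-- ★★ **THE FINITE-RANGE COROLLARY**: range `r` (`T_{xy} = 0` for `dist(x,y) > r`), block bound `a`, ball count `N`, `aN(e^{κr} − 1) < c` ⟹
`|π_x g|_β ≤ e^{−κ·dist(x,y)}·|w|_β ∕ (c − aN(e^{κr} − 1))`. [cite: Balaban1985BackgroundPropagators, (3.42) p.397, Thm 3.1 p.397] -/
theorem bsize_coord_le_exp_of_coercive_of_range (hβs : ∀ u v, β u v = β v u) (hβ0 : ∀ v, 0 ≤ β v v)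
    (hrec : ∀ v : V, ∑ i ∈ s, σ i (π i v) = v) (hππ : ∀ i ∈ s, ∀ w : F, π i (σ i w) = w)
    (hπ0 : ∀ i ∈ s, ∀ j ∈ s, i ≠ j → ∀ w : F, π i (σ j w) = 0)
    {dist : ι → ι → ℝ} (hd0 : ∀ x, dist x x = 0) (hds : ∀ x y, dist x y = dist y x) (hdt : ∀ x y z, dist x z ≤ dist x y + dist y z)
    {c r a κ : ℝ} {N : ℕ} (hr : 0 ≤ r) (ha : 0 ≤ a) (hκ : 0 ≤ κ)
    (hN : ∀ x ∈ s, (s.filter (fun y => dist x y ≤ r)).card ≤ N)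
    (hrange : ∀ x ∈ s, ∀ y ∈ s, ∀ w : F, r < dist x y → blk π σ T x y w = 0)
    (hblock : ∀ x ∈ s, ∀ y ∈ s, ∀ w : F, bsize β (blk π σ T x y w) ≤ a * bsize β w)
    (hco : ∀ v : V, c * cform β π s v v ≤ cform β π s v (T v)) (hϱ : a * N * (Real.exp (κ * r) - 1) < c)
    {g : V} {y : ι} (hy : y ∈ s) {w : F} (hg : T g = σ y w) {x : ι} (hx : x ∈ s) :
    bsize β (π x g) ≤ Real.exp (-(κ * dist x y)) / (c - a * N * (Real.exp (κ * r) - 1)) * bsize β w := by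
  classical
  refine bsize_coord_le_exp_of_coercive_of_rowcol hβs hβ0 hrec hππ hπ0 hd0 hds hdt hκ (fun x y => if dist x y ≤ r then a else 0)
    (fun x y => by split_ifs <;> [exact ha; exact le_rfl]) (fun x hx y hy w => ?_) (fun x hx => rowsum_of_range hr ha hκ (hN x hx))
    (fun y hy => ?_) hco hϱ hy hg hx
  · split_ifs with h
    · exact hblock x hx y hy w
    · rw [hrange x hx y hy w (lt_of_not_ge h), bsize_zero, zero_mul]
  · -- the column sum is a row sum of the symmetric majorant
    have hN' : (s.filter (fun x => dist y x ≤ r)).card ≤ N := hN y hy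
    have h := rowsum_of_range (s := s) (dist := dist) hr ha hκ hN'
    refine le_trans (le_of_eq (Finset.sum_congr rfl fun x _ => ?_)) h
    rw [hds x y]

end CombesThomas

end Literature.MathematicalPhysics.QuantumFieldTheory.Balaban1983to89.B9Eq342CombesThomasBlockForm

end
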